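import Literature.Probability.Percolation.GladkovThreeClusterDichotomyProofs
import HarnessLib

/-!
# `NoHeavyLowerTail` (stmt-CriticalPhenomena-4575) — certificate rows: REFINED decision-tree Cauchy–Schwarz row
# (Gladkov's Lemma 1.2 with the Cauchy–Schwarz step split along classes decided by the first exploration)

Support file (prover prim-ineq-gen-3, new-inequality factory; `--supports stmt-CriticalPhenomena-4575`).
No named facts, no sorries.

Gladkov's Lemma 1.2 [Gladkov2024, arXiv:2408.08457, (2)] (tree: `Gladkov.lemma_1_2`,
`gladkov2024_lemma_1_2_prodBernoulli`) reads, for three vertices `x, y, z` and `q = P(x|y|z)`,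
`q²/P(y isolated from x,z) + q²/P(z isolated from x,y) ≤ q + P(x isolated from y,z)²`; it is the row
family `dt` of the ttrl `wf3lp` certificate search.  Its proof bounds `P(C₁ ∈ x|y|z, C₁ →_{S₁} C₂ ∈ x|y|z)`
from below by `P(x|y|z)²/P(z|x ∩ z|y)` through the Cauchy–Schwarz inequality of Thm. 5.2 *summed over all
patterns of the exploration of `Com_z`*.  Splitting that sum along any event `c` DECIDED by this exploration
(here: "a further terminal hangs on the cluster of `z`") and applying Cauchy–Schwarz on each part gives the
sharper bound `P(x|y|z ∩ c)²/P(z|x ∩ z|y ∩ c) + P(x|y|z ∩ cᶜ)²/P(z|x ∩ z|y ∩ cᶜ)`, and hence the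
**refined inequality**
`Σ_{c} P(x|y|z ∩ c)²/P(iso z ∩ c) + Σ_{d} P(x|y|z ∩ d)²/P(iso y ∩ d) ≤ P(x|y|z) + P(iso x)²`
(`c` decided by `Com_z`, `d` by `Com_y`).  For five terminals `o, a₁, a₂, a₃, b` with `x = o, y = a₁, z = b`
and `c = {a₂ ∈ C_b ∨ a₃ ∈ C_b}`, `d = {a₂ ∈ C_{a₁} ∨ a₃ ∈ C_{a₁}}` this is the harness row `IG3-GDTany`
(degree 6 after clearing denominators); unlike the unrefined `dt` row it is violated by the pseudo-law
`fakelaw_U13_nearone_d0.2_finePA+all` of the (U₁)₃ LP (−2.08e-3 vs +2.04e-3), and it holds with 0 exact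
violations on the 74 635 realizable dump laws × 6 relabellings (prim-ineq-gen-3, FINDINGS.md F7).

Main declarations: `DTRefined.localOn_inter`, `DTRefined.localOn_compl`, `DTRefined.localOn_hang`,
`DTRefined.localOn_hang₂`, `DTRefined.sq_PrW_tri_inter_le`, `DTRefined.patternSum_add_compl_le`, `DTRefined.lemma_1_2_refined`,
`DTRefined.lemma_1_2_refined_div`, `dtRefined_prodBernoulli`, `dtRefined_prodBernoulli_set` (appended:
classes given by an arbitrary finite set `W` of extra terminals).

## References
* N. Gladkov, *Percolation Inequalities and Decision Trees*, arXiv:2408.08457v2 (2024), Lemma 1.2, Thm. 5.2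
  (proof, (8)–(10)), §7.1. [Gladkov2024]
* N. Gladkov, A. Zimin, *Bond percolation does not simulate site percolation*, arXiv:2404.08873, §4. [GladkovZimin2024]
-/

noncomputable section

namespace Summit.CriticalPhenomena.PercolationContinuityZ3.Theorems

namespace DTRefined

open Finset Literature.Probability.Percolation Literature.Probability.Percolation.DecisionTree
  Literature.Probability.Percolation.Gladkov
open scoped Classical

variable {V : Type*} [Fintype V] [DecidableEq V]

/-! ## Locality bookkeeping -/

omit [Fintype V] [DecidableEq V] in
/-- Intersections of events decided on `Fm` are decided on `Fm`. [folklore] -/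
theorem localOn_inter {ι : Type*} {Fm : Finset ι → Finset ι} {A B : Set (Finset ι)}
    (hA : LocalOn Fm A) (hB : LocalOn Fm B) : LocalOn Fm (A ∩ B) :=
  fun K K' h hK => ⟨hA K K' h hK.1, hB K K' h hK.2⟩

omit [Fintype V] [DecidableEq V] in
/-- Complements of events decided on a self-determined `Fm` are decided on `Fm`. [folklore] -/
theorem localOn_compl {ι : Type*} {Fm : Finset ι → Finset ι} (hFm : SelfDetermined Fm)
    {A : Set (Finset ι)} (hA : LocalOn Fm A) : LocalOn Fm Aᶜ := by
  intro K K' h hK hK'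
  have hFm' : Fm K' = Fm K := hFm K K' h
  refine hK (hA K' K (fun i hi => ?_) hK')
  rw [hFm'] at hi
  exact (h i hi).symm

/-- "Some vertex of `W` hangs on the cluster of `z`" is decided by exploring the cluster of `z`.
[cite: Gladkov2024, Cor. 5.3 (events decided by the exploration of a component)] -/
theorem localOn_hang (z : V) (W : Finset V) :
    LocalOn (fun K : Finset (Sym2 V) => touch (cl K z)) {K | ∃ u ∈ W, u ∈ cl K z} := by
  intro K K' h hK
  have hcl : cl K' z = cl K z := cl_eq_of_agree h
  simp only [Set.mem_setOf_eq, hcl] at hK ⊢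
  exact hK

/-- "`u` or `v` hangs on the cluster of `z`" is decided by exploring the cluster of `z`.
[cite: Gladkov2024, Cor. 5.3 (events decided by the exploration of a component)] -/
theorem localOn_hang₂ (z u v : V) :
    LocalOn (fun K : Finset (Sym2 V) => touch (cl K z)) {K | u ∈ cl K z ∨ v ∈ cl K z} := by
  intro K K' h hK
  have hcl : cl K' z = cl K z := cl_eq_of_agree h
  simp only [Set.mem_setOf_eq, hcl] at hK ⊢
  exact hK

/-! ## The refined `S₁` bound -/

section Estimates

variable {p : Sym2 V → ℝ} (hp0 : ∀ i, 0 ≤ p i) (hp1 : ∀ i, p i ≤ 1) (x y z : V)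

include hp0 hp1

/-- **Refined `S₁` bound** (Thm. 5.2 with `T₁` = exploration of `Com_z`, applied to the event
`x|y|z ∩ c` for `c` decided by that exploration): `P(x|y|z ∩ c)² ≤ P(z|x ∩ z|y ∩ c) · N(c)`, `N(c)` the pattern sum `Σ_π wtW(π) P_π({L | π ∪ L ∈ x|y|z ∩ c})²`.
[cite: Gladkov2024, Thm. 5.2, Cor. 5.3 (11)] -/
theorem sq_PrW_tri_inter_le (c : Set (Finset (Sym2 V)))
    (hc : LocalOn (fun K : Finset (Sym2 V) => touch (cl K z)) c) :
    PrW Finset.univ p (tri x y z ∩ c) ^ 2 ≤ PrW Finset.univ p (iso z x y ∩ c) *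
      (∑ π ∈ pats Finset.univ (fun K : Finset (Sym2 V) => touch (cl K z)),
        wtW (Finset.univ.filter (· ∈ touch (cl π z))) p π *
          PrW (Finset.univ \ touch (cl π z)) p {L | π ∪ L ∈ tri x y z ∩ c} ^ 2) :=
  sq_PrW_le_PrW_mul_sum_pats Finset.univ hp0 hp1 (selfDetermined_touch_cl z)
    (localOn_inter (localOn_iso z x y) hc) (Set.inter_subset_inter_left c (tri_subset_iso' x y z))

/-- Splitting the pattern sum: `N(c) + N(cᶜ) ≤ P(C₁ ∈ x|y|z, C₁ →_{S₁} C₂ ∈ x|y|z)`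
(pointwise `a² + b² ≤ (a + b)²` for the two sections, whose union is the section of `x|y|z`).
[cite: Gladkov2024, Thm. 5.2 (proof, (10)); Lemma 3.1] -/
theorem patternSum_add_compl_le (c : Set (Finset (Sym2 V))) :
    (∑ π ∈ pats Finset.univ (fun K : Finset (Sym2 V) => touch (cl K z)),
        wtW (Finset.univ.filter (· ∈ touch (cl π z))) p π *
          PrW (Finset.univ \ touch (cl π z)) p {L | π ∪ L ∈ tri x y z ∩ c} ^ 2) +
      (∑ π ∈ pats Finset.univ (fun K : Finset (Sym2 V) => touch (cl K z)),
        wtW (Finset.univ.filter (· ∈ touch (cl π z))) p π *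
          PrW (Finset.univ \ touch (cl π z)) p {L | π ∪ L ∈ tri x y z ∩ cᶜ} ^ 2) ≤
      Pr2W Finset.univ p {w | w.1 ∈ tri x y z ∧ splice (S1map x y z w.1) w.1 w.2 ∈ tri x y z} := by
  have hres := Pr2W_resample₂ Finset.univ p (R₁ := fun K : Finset (Sym2 V) => touch (cl K z))
    (R := fun K : Finset (Sym2 V) => touch (cl K z ∪ cl K x)) (S := S1tail x y z)
    (selfDetermined_touch_cl z) (selfDetermined_touch_cl_union z x)
    (fun K => touch_mono Finset.subset_union_left) (localOn_tri x y z) (disjoint_S1tail x y z)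
    (S1tail_congr x y z) (tri x y z)
  have heq : Pr2W Finset.univ p {w | w.1 ∈ tri x y z ∧ splice (S1map x y z w.1) w.1 w.2 ∈ tri x y z}
      = Pr2W Finset.univ p {w | w.1 ∈ tri x y z ∧
          splice (touch (cl w.1 z) ∪ S1tail x y z w.1) w.1 w.2 ∈ tri x y z} := rfl
  rw [heq, hres, ← Finset.sum_add_distrib]
  refine Finset.sum_le_sum fun π _ => ?_
  set D' : Finset (Sym2 V) := Finset.univ \ touch (cl π z) with hD'
  set a := PrW D' p {L | π ∪ L ∈ tri x y z ∩ c} with ha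
  set b := PrW D' p {L | π ∪ L ∈ tri x y z ∩ cᶜ} with hb
  set t := PrW D' p {L | π ∪ L ∈ tri x y z} with ht
  have hw : 0 ≤ wtW (Finset.univ.filter (· ∈ touch (cl π z))) p π := wtW_nonneg _ hp0 hp1 π
  have ha0 : 0 ≤ a := PrW_nonneg _ hp0 hp1 _
  have hb0 : 0 ≤ b := PrW_nonneg _ hp0 hp1 _
  have hab : a + b = t := by
    rw [ha, hb, ht, ← PrW_union D' p]
    · refine PrW_congr_set D' p fun L _ => ?_
      simp only [Set.mem_union, Set.mem_setOf_eq, Set.mem_inter_iff, Set.mem_compl_iff]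
      tauto
    · rw [Set.disjoint_left]
      rintro L ⟨-, h1⟩ ⟨-, h2⟩
      exact h2 h1
  rw [← mul_add]
  refine mul_le_mul_of_nonneg_left ?_ hw
  nlinarith [mul_nonneg ha0 hb0]

/-- **Refined Lemma 1.2 (primitive form).** For events `c` (decided by exploring `Com_z`) and `d`
(decided by exploring `Com_y`) there are `N₁, N₁', N₂, N₂' ≥ 0` with
`P(x|y|z ∩ c)² ≤ P(iso z ∩ c) N₁`, `P(x|y|z ∩ cᶜ)² ≤ P(iso z ∩ cᶜ) N₁'`,
`P(x|y|z ∩ d)² ≤ P(iso y ∩ d) N₂`, `P(x|y|z ∩ dᶜ)² ≤ P(iso y ∩ dᶜ) N₂'` and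
`N₁ + N₁' + N₂ + N₂' ≤ 2q − u(1 − u) + r` (`q = P(x|y|z)`, `u = P(iso x)`, `r = P(x|yz)`).
[cite: Gladkov2024, Lemma 1.2 and §7.1 (the same combination, with Thm. 5.2 applied per class)] -/
theorem lemma_1_2_refined (c d : Set (Finset (Sym2 V)))
    (hc : LocalOn (fun K : Finset (Sym2 V) => touch (cl K z)) c)
    (hd : LocalOn (fun K : Finset (Sym2 V) => touch (cl K y)) d) :
    ∃ N₁ N₁' N₂ N₂' : ℝ, 0 ≤ N₁ ∧ 0 ≤ N₁' ∧ 0 ≤ N₂ ∧ 0 ≤ N₂' ∧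
      PrW Finset.univ p (tri x y z ∩ c) ^ 2 ≤ PrW Finset.univ p (iso z x y ∩ c) * N₁ ∧
      PrW Finset.univ p (tri x y z ∩ cᶜ) ^ 2 ≤ PrW Finset.univ p (iso z x y ∩ cᶜ) * N₁' ∧
      PrW Finset.univ p (tri x y z ∩ d) ^ 2 ≤ PrW Finset.univ p (iso y x z ∩ d) * N₂ ∧
      PrW Finset.univ p (tri x y z ∩ dᶜ) ^ 2 ≤ PrW Finset.univ p (iso y x z ∩ dᶜ) * N₂' ∧
      N₁ + N₁' + N₂ + N₂' ≤ 2 * PrW Finset.univ p (tri x y z) -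
        PrW Finset.univ p (iso x y z) * (1 - PrW Finset.univ p (iso x y z)) +
          PrW Finset.univ p (iso x y z \ tri x y z) := by
  have hc' : LocalOn (fun K : Finset (Sym2 V) => touch (cl K z)) cᶜ :=
    localOn_compl (selfDetermined_touch_cl z) hc
  have hd' : LocalOn (fun K : Finset (Sym2 V) => touch (cl K y)) dᶜ :=
    localOn_compl (selfDetermined_touch_cl y) hd
  have hA := sq_PrW_tri_inter_le hp0 hp1 x y z c hc
  have hA' := sq_PrW_tri_inter_le hp0 hp1 x y z cᶜ hc'
  have hB := sq_PrW_tri_inter_le hp0 hp1 x z y d hd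
  have hB' := sq_PrW_tri_inter_le hp0 hp1 x z y dᶜ hd'
  rw [tri_swap] at hB hB'
  have hN1 := patternSum_add_compl_le hp0 hp1 x y z c
  have hN2 := patternSum_add_compl_le hp0 hp1 x z y d
  rw [tri_swap] at hN2
  have h1 := Pr2W_tri_S3_le hp0 hp1 x y z
  have h2 := Pr2W_iso_S3_le hp0 hp1 x y z (conn x y ∪ conn x z)
  have h3 := Pr2W_iso_S3_eq (p := p) x y z (conn x y ∪ conn x z)
  have h4 := PrW_iso_add_PrW_conn (p := p) x y z
  have h5 := Pr2W_add_Pr2W_le_PrW_tri hp0 hp1 x y z (S1map x y z)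
  have h6 := Pr2W_add_Pr2W_le_PrW_tri hp0 hp1 x z y (S1map x z y)
  rw [tri_swap] at h6
  have hU : PrW Finset.univ p (conn x y ∪ conn x z) = 1 - PrW Finset.univ p (iso x y z) := by
    linarith
  rw [hU] at h3
  have hnn : ∀ (v : V) (E : Set (Finset (Sym2 V))), 0 ≤ ∑ π ∈ pats Finset.univ
      (fun K : Finset (Sym2 V) => touch (cl K v)), wtW (Finset.univ.filter (· ∈ touch (cl π v))) p π *
        PrW (Finset.univ \ touch (cl π v)) p {L | π ∪ L ∈ E} ^ 2 :=
    fun v E => Finset.sum_nonneg fun π _ => mul_nonneg (wtW_nonneg _ hp0 hp1 π) (sq_nonneg _)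
  exact ⟨_, _, _, _, hnn z _, hnn z _, hnn y _, hnn y _, hA, hA', hB, hB', by linarith⟩

/-- **Refined Lemma 1.2 in closed (division) form**: with `q_E = P(x|y|z ∩ E)`,
`q_c²/P(iso z ∩ c) + q_{cᶜ}²/P(iso z ∩ cᶜ) + q_d²/P(iso y ∩ d) + q_{dᶜ}²/P(iso y ∩ dᶜ) ≤ P(x|y|z) + P(iso x)²`
(a vanishing denominator makes its term `0`). [cite: Gladkov2024, Lemma 1.2 (2), refined per class] -/
theorem lemma_1_2_refined_div (c d : Set (Finset (Sym2 V)))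
    (hc : LocalOn (fun K : Finset (Sym2 V) => touch (cl K z)) c)
    (hd : LocalOn (fun K : Finset (Sym2 V) => touch (cl K y)) d) :
    PrW Finset.univ p (tri x y z ∩ c) ^ 2 / PrW Finset.univ p (iso z x y ∩ c) +
        PrW Finset.univ p (tri x y z ∩ cᶜ) ^ 2 / PrW Finset.univ p (iso z x y ∩ cᶜ) +
        PrW Finset.univ p (tri x y z ∩ d) ^ 2 / PrW Finset.univ p (iso y x z ∩ d) +
        PrW Finset.univ p (tri x y z ∩ dᶜ) ^ 2 / PrW Finset.univ p (iso y x z ∩ dᶜ) ≤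
      PrW Finset.univ p (tri x y z) + PrW Finset.univ p (iso x y z) ^ 2 := by
  obtain ⟨N₁, N₁', N₂, N₂', hN₁, hN₁', hN₂, hN₂', h1, h1', h2, h2', h3⟩ :=
    lemma_1_2_refined hp0 hp1 x y z c d hc hd
  have hur : PrW Finset.univ p (iso x y z) =
      PrW Finset.univ p (tri x y z) + PrW Finset.univ p (iso x y z \ tri x y z) := by
    rw [← PrW_union _ p Set.disjoint_sdiff_right]
    refine PrW_congr_set _ p fun K _ => ?_
    simp only [Set.mem_union, Set.mem_sdiff]
    constructor
    · intro h
      by_cases ht : K ∈ tri x y z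
      · exact Or.inl ht
      · exact Or.inr ⟨h, ht⟩
    · rintro (h | h)
      · exact tri_subset_iso _ _ _ h
      · exact h.1
  have hdiv : ∀ {s t N : ℝ}, 0 ≤ N → s ^ 2 ≤ t * N → 0 ≤ t → s ^ 2 / t ≤ N := by
    intro s t N hN hst ht
    rcases ht.eq_or_lt with h0 | hpos
    · rw [← h0, div_zero]; exact hN
    · rw [div_le_iff₀ hpos]; linarith
  have hd1 := hdiv hN₁ h1 (PrW_nonneg Finset.univ hp0 hp1 _)
  have hd1' := hdiv hN₁' h1' (PrW_nonneg Finset.univ hp0 hp1 _)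
  have hd2 := hdiv hN₂ h2 (PrW_nonneg Finset.univ hp0 hp1 _)
  have hd2' := hdiv hN₂' h2' (PrW_nonneg Finset.univ hp0 hp1 _)
  rw [hur] at h3 ⊢
  have e : ∀ q r : ℝ, 2 * q - (q + r) * (1 - (q + r)) + r = q + (q + r) ^ 2 := fun q r => by ring
  linarith [e (PrW Finset.univ p (tri x y z)) (PrW Finset.univ p (iso x y z \ tri x y z))]

end Estimates

end DTRefined

/-! ## The row for `prodBernoulli w` on five terminals -/

section Measure

open MeasureTheory Literature.Probability.LatticeModels Literature.Probability.Percolation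
  Literature.Probability.Percolation.Gladkov Literature.Probability.Percolation.DecisionTree DTRefined
open scoped Classical

/-- **Refined decision-tree row (harness `IG3-GDTany`) for `prodBernoulli w`** on a finite vertex type,
terminals `o, a₁, a₂, a₃, b`: with `T = {o≁a₁, o≁b, b≁a₁}` (`o|a₁|b`), `I_b = {b≁o, b≁a₁}`,
`I_{a₁} = {a₁≁o, a₁≁b}`, `I_o = {o≁a₁, o≁b}`, `C_b = {b~a₂ ∨ b~a₃}`, `C_{a₁} = {a₁~a₂ ∨ a₁~a₃}`:
`μ(T∩C_b)²/μ(I_b∩C_b) + μ(T∩C_bᶜ)²/μ(I_b∩C_bᶜ) + μ(T∩C_{a₁})²/μ(I_{a₁}∩C_{a₁}) + μ(T∩C_{a₁}ᶜ)²/μ(I_{a₁}∩C_{a₁}ᶜ)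
 ≤ μ(T) + μ(I_o)²`.
[cite: Gladkov2024, Lemma 1.2 (2) and Thm. 5.2, arXiv:2408.08457 — refined per exploration class] -/
theorem dtRefined_prodBernoulli {V : Type*} [Fintype V] (w : Sym2 V → unitInterval)
    (o a₁ a₂ a₃ b : V) :
    (prodBernoulli w).real ((openConn o a₁)ᶜ ∩ (openConn o b)ᶜ ∩ (openConn b a₁)ᶜ ∩
          (openConn b a₂ ∪ openConn b a₃)) ^ 2 /
        (prodBernoulli w).real ((openConn b o)ᶜ ∩ (openConn b a₁)ᶜ ∩ (openConn b a₂ ∪ openConn b a₃)) +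
      (prodBernoulli w).real ((openConn o a₁)ᶜ ∩ (openConn o b)ᶜ ∩ (openConn b a₁)ᶜ ∩
          (openConn b a₂ ∪ openConn b a₃)ᶜ) ^ 2 /
        (prodBernoulli w).real ((openConn b o)ᶜ ∩ (openConn b a₁)ᶜ ∩ (openConn b a₂ ∪ openConn b a₃)ᶜ) +
      (prodBernoulli w).real ((openConn o a₁)ᶜ ∩ (openConn o b)ᶜ ∩ (openConn b a₁)ᶜ ∩
          (openConn a₁ a₂ ∪ openConn a₁ a₃)) ^ 2 /
        (prodBernoulli w).real ((openConn a₁ o)ᶜ ∩ (openConn a₁ b)ᶜ ∩ (openConn a₁ a₂ ∪ openConn a₁ a₃)) +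
      (prodBernoulli w).real ((openConn o a₁)ᶜ ∩ (openConn o b)ᶜ ∩ (openConn b a₁)ᶜ ∩
          (openConn a₁ a₂ ∪ openConn a₁ a₃)ᶜ) ^ 2 /
        (prodBernoulli w).real ((openConn a₁ o)ᶜ ∩ (openConn a₁ b)ᶜ ∩ (openConn a₁ a₂ ∪ openConn a₁ a₃)ᶜ) ≤
    (prodBernoulli w).real ((openConn o a₁)ᶜ ∩ (openConn o b)ᶜ ∩ (openConn b a₁)ᶜ) +
      (prodBernoulli w).real ((openConn o a₁)ᶜ ∩ (openConn o b)ᶜ) ^ 2 := by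
  classical
  have hp0 : ∀ e, 0 ≤ (fun e => (w e : ℝ)) e := fun e => (w e).2.1
  have hp1 : ∀ e, (fun e => (w e : ℝ)) e ≤ 1 := fun e => (w e).2.2
  have hcl : ∀ (S : Finset (Sym2 V)) (u v : V), (↑S : Set (Sym2 V)) ∈ openConn u v ↔ v ∈ cl S u :=
    fun S u v => by rw [mem_cl]; rfl
  rw [prodBernoulli_real_eq_PrW_univ w (X := tri o a₁ b ∩ {K | a₂ ∈ cl K b ∨ a₃ ∈ cl K b}) fun S => by
      simp only [tri, Set.mem_inter_iff, Set.mem_compl_iff, Set.mem_union, Set.mem_setOf_eq, hcl]; tauto,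
    prodBernoulli_real_eq_PrW_univ w (X := iso b o a₁ ∩ {K | a₂ ∈ cl K b ∨ a₃ ∈ cl K b}) fun S => by
      simp only [iso, Set.mem_inter_iff, Set.mem_compl_iff, Set.mem_union, Set.mem_setOf_eq, hcl],
    prodBernoulli_real_eq_PrW_univ w (X := tri o a₁ b ∩ {K | a₂ ∈ cl K b ∨ a₃ ∈ cl K b}ᶜ) fun S => by
      simp only [tri, Set.mem_inter_iff, Set.mem_compl_iff, Set.mem_union, Set.mem_setOf_eq, hcl]; tauto,
    prodBernoulli_real_eq_PrW_univ w (X := iso b o a₁ ∩ {K | a₂ ∈ cl K b ∨ a₃ ∈ cl K b}ᶜ) fun S => by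
      simp only [iso, Set.mem_inter_iff, Set.mem_compl_iff, Set.mem_union, Set.mem_setOf_eq, hcl],
    prodBernoulli_real_eq_PrW_univ w (X := tri o a₁ b ∩ {K | a₂ ∈ cl K a₁ ∨ a₃ ∈ cl K a₁}) fun S => by
      simp only [tri, Set.mem_inter_iff, Set.mem_compl_iff, Set.mem_union, Set.mem_setOf_eq, hcl]; tauto,
    prodBernoulli_real_eq_PrW_univ w (X := iso a₁ o b ∩ {K | a₂ ∈ cl K a₁ ∨ a₃ ∈ cl K a₁}) fun S => by
      simp only [iso, Set.mem_inter_iff, Set.mem_compl_iff, Set.mem_union, Set.mem_setOf_eq, hcl],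
    prodBernoulli_real_eq_PrW_univ w (X := tri o a₁ b ∩ {K | a₂ ∈ cl K a₁ ∨ a₃ ∈ cl K a₁}ᶜ) fun S => by
      simp only [tri, Set.mem_inter_iff, Set.mem_compl_iff, Set.mem_union, Set.mem_setOf_eq, hcl]; tauto,
    prodBernoulli_real_eq_PrW_univ w (X := iso a₁ o b ∩ {K | a₂ ∈ cl K a₁ ∨ a₃ ∈ cl K a₁}ᶜ) fun S => by
      simp only [iso, Set.mem_inter_iff, Set.mem_compl_iff, Set.mem_union, Set.mem_setOf_eq, hcl],
    prodBernoulli_real_eq_PrW_univ w (X := tri o a₁ b) fun S => by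
      simp only [tri, Set.mem_inter_iff, Set.mem_compl_iff, Set.mem_setOf_eq, hcl]; tauto,
    prodBernoulli_real_eq_PrW_univ w (X := iso o a₁ b) fun S => by
      simp only [iso, Set.mem_setOf_eq, Set.mem_inter_iff, Set.mem_compl_iff, hcl]]
  exact lemma_1_2_refined_div hp0 hp1 o a₁ b _ _ (localOn_hang₂ b a₂ a₃) (localOn_hang₂ a₁ a₂ a₃)

end Measure

/-! ## The row with an arbitrary finite set of extra terminals (appended, prim-ineq-gen-3) -/

section MeasureSet

open MeasureTheory Literature.Probability.LatticeModels Literature.Probability.Percolation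
  Literature.Probability.Percolation.Gladkov Literature.Probability.Percolation.DecisionTree DTRefined
open scoped Classical

/-- **Refined decision-tree row with a set `W` of extra terminals** (`prodBernoulli w`, any finite vertex
type): as `dtRefined_prodBernoulli` but with the classes `C_b = {∃ u ∈ W, b ~ u}`, `C_{a₁} = {∃ u ∈ W, a₁ ~ u}`
(for `|A| = k` relays take `W = A ∖ {a₁}`):
`μ(T∩C_b)²/μ(I_b∩C_b) + μ(T∩C_bᶜ)²/μ(I_b∩C_bᶜ) + μ(T∩C_{a₁})²/μ(I_{a₁}∩C_{a₁}) + μ(T∩C_{a₁}ᶜ)²/μ(I_{a₁}∩C_{a₁}ᶜ)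
 ≤ μ(T) + μ(I_o)²`, `T = {o≁a₁, o≁b, b≁a₁}`, `I_b = {b≁o, b≁a₁}`, `I_{a₁} = {a₁≁o, a₁≁b}`, `I_o = {o≁a₁, o≁b}`.
[cite: Gladkov2024, Lemma 1.2 (2) and Thm. 5.2, arXiv:2408.08457 — refined per exploration class] -/
theorem dtRefined_prodBernoulli_set {V : Type*} [Fintype V] (w : Sym2 V → unitInterval)
    (o a₁ b : V) (W : Finset V) :
    (prodBernoulli w).real ((openConn o a₁)ᶜ ∩ (openConn o b)ᶜ ∩ (openConn b a₁)ᶜ ∩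
          (⋃ u ∈ W, openConn b u)) ^ 2 /
        (prodBernoulli w).real ((openConn b o)ᶜ ∩ (openConn b a₁)ᶜ ∩ (⋃ u ∈ W, openConn b u)) +
      (prodBernoulli w).real ((openConn o a₁)ᶜ ∩ (openConn o b)ᶜ ∩ (openConn b a₁)ᶜ ∩
          (⋃ u ∈ W, openConn b u)ᶜ) ^ 2 /
        (prodBernoulli w).real ((openConn b o)ᶜ ∩ (openConn b a₁)ᶜ ∩ (⋃ u ∈ W, openConn b u)ᶜ) +
      (prodBernoulli w).real ((openConn o a₁)ᶜ ∩ (openConn o b)ᶜ ∩ (openConn b a₁)ᶜ ∩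
          (⋃ u ∈ W, openConn a₁ u)) ^ 2 /
        (prodBernoulli w).real ((openConn a₁ o)ᶜ ∩ (openConn a₁ b)ᶜ ∩ (⋃ u ∈ W, openConn a₁ u)) +
      (prodBernoulli w).real ((openConn o a₁)ᶜ ∩ (openConn o b)ᶜ ∩ (openConn b a₁)ᶜ ∩
          (⋃ u ∈ W, openConn a₁ u)ᶜ) ^ 2 /
        (prodBernoulli w).real ((openConn a₁ o)ᶜ ∩ (openConn a₁ b)ᶜ ∩ (⋃ u ∈ W, openConn a₁ u)ᶜ) ≤
    (prodBernoulli w).real ((openConn o a₁)ᶜ ∩ (openConn o b)ᶜ ∩ (openConn b a₁)ᶜ) +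
      (prodBernoulli w).real ((openConn o a₁)ᶜ ∩ (openConn o b)ᶜ) ^ 2 := by
  classical
  have hp0 : ∀ e, 0 ≤ (fun e => (w e : ℝ)) e := fun e => (w e).2.1
  have hp1 : ∀ e, (fun e => (w e : ℝ)) e ≤ 1 := fun e => (w e).2.2
  have hcl : ∀ (S : Finset (Sym2 V)) (u v : V), (↑S : Set (Sym2 V)) ∈ openConn u v ↔ v ∈ cl S u :=
    fun S u v => by rw [mem_cl]; rfl
  have hU : ∀ (S : Finset (Sym2 V)) (z : V), (↑S : Set (Sym2 V)) ∈ (⋃ u ∈ W, openConn z u) ↔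
      S ∈ {K : Finset (Sym2 V) | ∃ u ∈ W, u ∈ cl K z} := fun S z => by
    simp only [Set.mem_iUnion, Set.mem_setOf_eq, hcl, exists_prop]
  rw [prodBernoulli_real_eq_PrW_univ w (X := tri o a₁ b ∩ {K | ∃ u ∈ W, u ∈ cl K b}) fun S => by
      rw [Set.mem_inter_iff, Set.mem_inter_iff, hU]
      simp only [tri, Set.mem_inter_iff, Set.mem_compl_iff, Set.mem_setOf_eq, hcl]; tauto,
    prodBernoulli_real_eq_PrW_univ w (X := iso b o a₁ ∩ {K | ∃ u ∈ W, u ∈ cl K b}) fun S => by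
      rw [Set.mem_inter_iff, Set.mem_inter_iff, hU]
      simp only [iso, Set.mem_inter_iff, Set.mem_compl_iff, Set.mem_setOf_eq, hcl],
    prodBernoulli_real_eq_PrW_univ w (X := tri o a₁ b ∩ {K | ∃ u ∈ W, u ∈ cl K b}ᶜ) fun S => by
      rw [Set.mem_inter_iff, Set.mem_inter_iff, Set.mem_compl_iff, Set.mem_compl_iff, hU]
      simp only [tri, Set.mem_inter_iff, Set.mem_compl_iff, Set.mem_setOf_eq, hcl]; tauto,
    prodBernoulli_real_eq_PrW_univ w (X := iso b o a₁ ∩ {K | ∃ u ∈ W, u ∈ cl K b}ᶜ) fun S => by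
      rw [Set.mem_inter_iff, Set.mem_inter_iff, Set.mem_compl_iff, Set.mem_compl_iff, hU]
      simp only [iso, Set.mem_inter_iff, Set.mem_compl_iff, Set.mem_setOf_eq, hcl],
    prodBernoulli_real_eq_PrW_univ w (X := tri o a₁ b ∩ {K | ∃ u ∈ W, u ∈ cl K a₁}) fun S => by
      rw [Set.mem_inter_iff, Set.mem_inter_iff, hU]
      simp only [tri, Set.mem_inter_iff, Set.mem_compl_iff, Set.mem_setOf_eq, hcl]; tauto,
    prodBernoulli_real_eq_PrW_univ w (X := iso a₁ o b ∩ {K | ∃ u ∈ W, u ∈ cl K a₁}) fun S => by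
      rw [Set.mem_inter_iff, Set.mem_inter_iff, hU]
      simp only [iso, Set.mem_inter_iff, Set.mem_compl_iff, Set.mem_setOf_eq, hcl],
    prodBernoulli_real_eq_PrW_univ w (X := tri o a₁ b ∩ {K | ∃ u ∈ W, u ∈ cl K a₁}ᶜ) fun S => by
      rw [Set.mem_inter_iff, Set.mem_inter_iff, Set.mem_compl_iff, Set.mem_compl_iff, hU]
      simp only [tri, Set.mem_inter_iff, Set.mem_compl_iff, Set.mem_setOf_eq, hcl]; tauto,
    prodBernoulli_real_eq_PrW_univ w (X := iso a₁ o b ∩ {K | ∃ u ∈ W, u ∈ cl K a₁}ᶜ) fun S => by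
      rw [Set.mem_inter_iff, Set.mem_inter_iff, Set.mem_compl_iff, Set.mem_compl_iff, hU]
      simp only [iso, Set.mem_inter_iff, Set.mem_compl_iff, Set.mem_setOf_eq, hcl],
    prodBernoulli_real_eq_PrW_univ w (X := tri o a₁ b) fun S => by
      simp only [tri, Set.mem_inter_iff, Set.mem_compl_iff, Set.mem_setOf_eq, hcl]; tauto,
    prodBernoulli_real_eq_PrW_univ w (X := iso o a₁ b) fun S => by
      simp only [iso, Set.mem_setOf_eq, Set.mem_inter_iff, Set.mem_compl_iff, hcl]]
  exact lemma_1_2_refined_div hp0 hp1 o a₁ b _ _ (localOn_hang b W) (localOn_hang a₁ W)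

end MeasureSet

end Summit.CriticalPhenomena.PercolationContinuityZ3.Theorems
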